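import Mathlib
import HarnessLib
import HarnessLib.Audit
import Summits.AtomisticToContinuum.Statement
import Literature.MathematicalPhysics.KineticTheory.LangevinChainKernel
import Literature.MathematicalPhysics.KineticTheory.LangevinChainGibbs
import Literature.MathematicalPhysics.KineticTheory.LangevinChainNESSHolds
import Summits.AtomisticToContinuum.FouriersLaw.Theorems.EmbeddedDrudeMourreNessUnique
import HarnessLib.Audit.Status.Attr

/-!
Route: HonestZwanzig

DORMANT since 2026-08-26T06:32:50Z (reconciler: no traction for 8.4 d (last activity item-evidence-added at 2026-08-17T20:58:21Z); parked, not closed — `ledger route dormant route-AtomisticToContinuum-HonestZwanzig --off` to reactivate) — unstaffed, not closed; items shared with open routes are served there. `ledger route dormant <id> --off` reactivates.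

# Route HonestZwanzig — Honest Zwanzig — Fourier's law as the Feshbach–Schur complement of the
thermostatted Liouvillian on energy profiles; an N-uniform Ohm law for the orthogonal dynamics gives
κ (re-files FeshbachMemory)

X_HZ (HONEST ZWANZIG; realises idea card feshbach-energy-profile-memory; D-0027 §2.1-conforming
re-filing of route FeshbachMemory, retired 2026-08-15 `not-a-thesis` only for want of a deciding
theorem — its eleven statements are kept verbatim (refuter rreview c3531e67: 11/11 rc 0, sound) and
`theorem closes … : _root_.FouriersLaw` is now PROVED). Fix pinnedChain ω₂ lam β γ (all > 0), T > 0,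
N ≥ 2 and the CANONICAL equilibrium objects of the tree: μ = gibbsMeasure N T, P_t =
transitionKernel N T T t (both baths at T); corr(f,g)(t) = ∫ f·(P_t g) dμ − μ(f)μ(g), lap_s its
Laplace transform, G(s) = [lap_s(e_x,e_y)] for the symmetrically split site energies e_x, and the
SCHUR COMPLEMENT schur_s(f,g) = lap_s(f,g) − lap_s(f,e)·G(s)⁻¹·lap_s(e,g), which is exactly ⟨Qf,(s −
QLQ)⁻¹Qg⟩_μ, the resolvent of Zwanzig's ORTHOGONAL DYNAMICS for the projection P onto span{1, e_x}
(no unbounded-operator theory is needed to state it). With J = Σ_b j_b it suffices to show X = X1 ∧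
X2 ∧ X3: (X1, OrthogonalOhm) the orthogonal-dynamics DC responses ρ_b = lim_{s↓0} schur_s(j_b, J)
exist, are bounded uniformly in N and converge to one constant k(T) uniformly over bulk bonds, the
two contact responses lim schur_s(p_b², J), b ∈ {0, N−1}, being bounded; (X2, PositiveMemory) bulk
ρ_b ≥ k₀(T) > 0; (X3, RobinCoercivity) the Feshbach matrix 𝔽_N(s) = s·Cov(e,e) − Cov(e,Le) −
schur_s(L†e, Le) (= Cov(e,e)·G(s)⁻¹·Cov(e,e), the Schur complement of s − L_N on the energy
profiles) dominates c·(path Laplacian + unit Robin ends) uniformly in N for small s. Fixed-N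
support: the Kundu–Dhar–Narayan open-chain Green–Kubo identity (N−1)T²D_N = ∫₀^∞corr(J,J)
(OpenChainGreenKubo), the Kolmogorov / time-reversal / positivity package behind the Feshbach block
algebra (FeshbachIdentities), L e_x = j_{x−1} − j_x + bath terms (GeneratorSiteEnergy), parity
statics (ParityStatics), and the deterministic reduction NetworkReduction (discrete Robin network +
1-D homogenisation): X ⇒ ∫₀^∞corr(J,J)/(N−1) → k(T) > 0 (MemoryConductivity). Then D_N → κ(T) :=
k(T)/T² ∈ (0,∞) for every steady-state family (NessUnique, shared item
stmt-AtomisticToContinuum-0741), clause (i) from the PROVED fact pinnedChain_exists_isSteadyState +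
NessUnique, hence the sub-problem Statement `FouriersLaw`.
Lean: `OrthogonalOhm ∧ PositiveMemory ∧ RobinCoercivity`

## Assembly
Deciding theorem (D-0027 §2.1) PROVED in the planner folder (glue.lean; GlueCheck.lean = route decls
+ `closes`, `import Mathlib`, lean check rc 0, axioms propext / Classical.choice / Quot.sound):
`theorem closes (hNU : NessUnique) (hGK : OpenChainGreenKubo) (hGSE : GeneratorSiteEnergy) (hPS :
ParityStatics) (hFI : FeshbachIdentities) (hOO : OrthogonalOhm) (hPM : PositiveMemory) (hRC :
RobinCoercivity) (hNR : NetworkReduction) : _root_.FouriersLaw` — hypotheses are route items only,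
conclusion is the sub-problem Statement decl by name. Proof (45 lines of logic): MemoryConductivity
:= NetworkReduction applied to its six antecedents; clause (i) from
Literature.MathematicalPhysics.KineticTheory.HeatConduction.pinnedChain_exists_isSteadyState
(proved, LangevinChainNESSHolds, all N) + NessUnique; κ T := k(T)/T² (Classical.choose from
MemoryConductivity for T > 0, else 1), positive by div_pos; for a steady-state family μ and T > 0
put D N := (∫₀^∞corr(J,J)/(N−1))/T² for N ≥ 2 and D N := 0 for N ≤ 1 (no bond: bondCurrent and
totalCurrent vanish identically, `omega` on Fin N); OpenChainGreenKubo (fed NessUnique) gives the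
δ-limits for N ≥ 2 (`div_div`), the constant 0 for N ≤ 1; MemoryConductivity/T² gives D N → κ T
(Filter.Tendsto.div_const + eventual equality from N ≥ 2). The Assembly item below is the same
implication as a Prop (`example : Assembly = (NessUnique → … → NetworkReduction →
_root_.FouriersLaw) := rfl` in Sketch.lean). Provers: import
Literature.MathematicalPhysics.KineticTheory.LangevinChainKernel, …LangevinChainGibbs,
…LangevinChainNESSHolds (or the route file).

Rationale: WHY THIS LINE. Make the textbook Mori–Zwanzig derivation of the heat equation (Zwanzig2001 Ch. 8–9,
Gaspard2022 §2.9.2; ChorinHaldKupferman2000, GivonKupfermanStuart2004 for rigorous model problems;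
ChuLi2019 Thm 3 for block energies of an FPU chain with the parity-vanishing Markovian term) an
EXACT finite-N identity for the OPEN thermostatted chain: by Feshbach–Schur isospectrality
(BachFrohlichSigal1998, GustafsonSigal2003) the compression of (s − L_N)⁻¹ to the energy profiles is
the inverse of 𝔽_N(s) = sχ + Γ_b + ∇ᵀ𝔎_N(s)∇ + (contact memory), a discrete divergence-form operator
on the path graph with Robin ends — Γ_b = γT²(δ_0δ_0ᵀ + δ_{N−1}δ_{N−1}ᵀ) is Newton cooling at the
baths (parity kills the Euler block) and 𝔎_N(s)_{bb′} = schur_s(j_b, j_{b′}) is the bond-current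
memory of the ORTHOGONAL dynamics; with the Kundu–Dhar–Narayan identity (KunduDharNarayan2009,
arXiv:0809.4543 p. 3: G = T⁻²∫⟨j̄ j̄(t)⟩, j̄ = J/(N−1)) one gets the exact circuit formula
lap_s(J,J) = schur_s(J,J) − m(s)ᵀ𝔽_N(s)⁻¹m(s), m_y = schur_s(J, L e_y) ("total bond memory minus the
backflow through the slow sector"; for a local kernel K it is (N−1)²/((N−1)/K + 2/(γT²)): N−1
resistors T²/K in series with two contact resistances 1/γ). Imported areas, with the dictionary made
literal by the Schur-complement gadget: Feshbach maps of open quantum systems / spectral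
renormalisation, memory-function hydrodynamics (Zwanzig2001, Forster2018), limiting absorption
(regularity of one resolvent family at one frequency), discrete elliptic homogenisation with Robin
boundary (ArmstrongKuusiMourrat2019 for the 1-D convolution-type coefficient); the kinetic analogues
are Ellis–Pinsky's hydrodynamic branches and Gaspard1998 §6.4 multibaker resonances. What it does
that the open routes do not: FourierGreenKubo needs infinite-volume dynamics and L¹ decay of the
FULL current correlation; OddSectorIrreversibility / CurrentTiltQuench work in the odd sector of the
unprojected semigroup; BondHeatUncertainty uses fluctuation relations; here everything is finite-N,
equilibrium, canonical (gibbsMeasure, transitionKernel), the N slow directions whose rates close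
(BeckerMenegaki2022_gapClosing, λ_S ≤ γ/N proved in tree) are removed BY HAND, and the N → ∞ input
asked of the dynamics is regularity at ONE frequency of the orthogonal resolvent tested on currents
plus coercivity of the complement. Negatives index (ledger negatives, 2026-08-15): six refuted
statements in the summit, none in FouriersLaw, none near these items.

RANKED CRUXES. #2 OrthogonalOhm (crux) — (card item (C) MemoryRegularity, in Schur-complement form)
for pinnedChain (all parameters > 0) and T > 0 there are k, C such that for every ε > 0 there is R
with: for all N ≥ 2 and every bond b, the orthogonal-dynamics DC response ρ_b = lim_{s↓0}
schur_s(j_b, J) exists (limiting absorption at zero frequency in the current sector), |ρ_b| ≤ C, and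
|ρ_b − k| ≤ ε whenever b is at distance ≥ R from both ends (local Ohm law of the orthogonal
dynamics, homogeneous in the bulk); and the two contact responses lim_{s↓0} schur_s(p_b², J), b ∈
{0, N−1}, exist with modulus ≤ C. Since schur_s(J,J) ≥ lap_s(J,J) (time reversal), Σ_b ρ_b ≥
(N−1)T²D_N: the boundedness clause is at least HasBoundedResponse (refuter remark, recorded).
[difficulty: open-problem] (why it might fail: Σ_bρ_b ≥ (N−1)T²D_N, so |ρ_b| ≤ C already contains
HasBoundedResponse; a Drude pole may survive in QLQ (harmonic: ρ_b ~ N; hidden odd charge, Mazur),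
or two-diffuson modes ẽẽ ∈ Ran Q (rates ~N⁻²) keep non-O(1/N) residues so ρ_b drifts with N;
compacts of T>0 only.) [Zwanzig2001, KunduDharNarayan2009, BonettoLebowitzReyBellet2000,
BeckerMenegaki2022, ChuLi2019, HairerMattingly2009]
#3 PositiveMemory (crux) — (card item PositiveSymbol) for pinnedChain (all > 0) and T > 0 there are
k₀ > 0 and R such that for all N ≥ 2 and every bulk bond b (distance ≥ R from both ends), any limit
ρ_b = lim_{s↓0} schur_s(j_b, J) satisfies ρ_b ≥ k₀ — the orthogonal dynamics is not an insulator; k₀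
is a T⁻²-normalised lower bound for κ. [deps: OrthogonalOhm] [difficulty: L] (why it might fail: No
Thomson-type lower bound is known for the NON-reversible projected resolvent; ρ_b could tend to 0 if
bond currents were asymptotically QLQ-coboundaries (orthogonal dynamics insulating) — absurd for a
clean chain but unproved; low T makes k₀(T) ~ (lam T)⁻²-scale delicate.)
[BonettoLebowitzReyBellet2000, Zwanzig2001, LandimMarianiSeo2018, AokiLukkarinenSpohn2006]
#4 RobinCoercivity (crux) — (the card's "discrete Robin heat operator", made quantitative) for
pinnedChain (all > 0) and T > 0 there is c > 0 such that for every N ≥ 2 there is s₀ > 0 with: for 0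
< s < s₀ and every profile ξ ∈ ℝ^N, ξᵀ𝔽_N(s)ξ ≥ c·(Σ_b (ξ_{b+1} − ξ_b)² + ξ_0² + ξ_{N−1}²), where
𝔽_N(s)_{xy} = s·Cov(e_x,e_y) − Cov(e_x, L e_y) − schur_s(L†e_x, L e_y) with L†e_x = (L e_x)∘(p ↦ −p)
— uniform ellipticity (with Robin ends) of the Feshbach–Schur complement of s − L_N on the energy
profiles; equivalently ∫₀^∞Cov(Σa_xe_x, Σa_xe_x(t))dt ≤ c⁻¹ aᵀχ(Δ_N + E_∂)⁻¹χa: time-integrated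
energy fluctuations relax at least as fast as a Robin heat flow. [difficulty: open-problem] (why it
might fail: Long-lived localised nonlinear excitations in the bulk (breathers / hot spots; cf.
Hairer–Mattingly slow relaxation when pinning dominates) could make time-integrated energy
autocorrelations super-diffusive (≫ N), or the renormalised contact conductance γT² − γ²⟨w_b,R_Q
w_b⟩ could degenerate with N.) [HairerMattingly2009, CuneoEckmannHairerReyBellet2018,
BeckerMenegaki2022, Zwanzig2001, Dhar2008]
#9 OpenChainGreenKubo (support) — (Kundu–Dhar–Narayan open-system Green–Kubo identity, typed over
the canonical objects) under weak-NESS uniqueness, for every steady-state family, T > 0 and N ≥ 2: t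
↦ corr(J,J)(t) is integrable on (0,∞) and the clause-(ii) response limit exists and equals D_N =
∫₀^∞corr(J,J)/((N−1)T²) (KDN, arXiv:0809.4543 p. 3: conductance G = (1/T²)∫⟨j̄(t)j̄(0)⟩, j̄ =
J/(N−1); our D_N = (N−1)·J̃/δT = (N−1)G). Physics-level in print for Langevin baths (BLR: "(32) has
not been proved"); rigorous route: Hairer–Majda differentiability of the NESS at equilibrium + KDN's
Novikov / time-reversal / continuity-equation steps; supplies FiniteResponse (stmt-0717) for N ≥ 2
as a by-product; it is a hypothesis of the deciding theorem. [difficulty: L] [KunduDharNarayan2009,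
BonettoLebowitzReyBellet2000, ReyBellet2003, HairerMajda2009, CuneoEckmannHairerReyBellet2018]
#9 FeshbachIdentities (support) — (fixed-N package behind the Feshbach block algebra, for the
constructed equilibrium semigroup) for N ≥ 2, T > 0: (0) the Gibbs measure is invariant under the
transition kernels; for observables f, g continuous with |f|,|g| ≤ A·e^{H/(8T)}: (i) f and f·(P_t g)
are μ-integrable and corr(f,g) ∈ L¹(0,∞) (fixed-N exponential mixing, CEHR Thm 2.13(3)); (ii) time
reversal corr(f,g)(t) = corr(g∘Θ, f∘Θ)(t), Θ(q,p) = (q,−p) (detailed balance); (iii) the Kolmogorov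
identities s·lap_s(e_x,g) − Cov(e_x,g) = lap_s((Le_x)∘Θ, g) and s·lap_s(f,e_x) − Cov(f,e_x) =
lap_s(f, Le_x); (iv) Cov(e,e) and G(s) (s > 0) are positive definite. From these the prover of
NetworkReduction derives 𝔽 = χG⁻¹χ and lap_s(J,J) = schur_s(J,J) − mᵀ𝔽⁻¹m by finite-dimensional
linear algebra (re-derived by this planner, NOTES.md). [difficulty: L]
[CuneoEckmannHairerReyBellet2018, KunduDharNarayan2009, Zwanzig2001, GivonKupfermanStuart2004]
#9 GeneratorSiteEnergy (support) — (structural lemma QLẽ = ∇·j, provable now) for N ≥ 2 and every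
site x: L e_x = j_{x−1} − j_x + [x=0]γ(T_L − p_0²) + [x=N−1]γ(T_R − p_{N−1}²) pointwise, for the
symmetrically split site energy e_x = p_x²/2 + U(q_x) + ½V(q_{x+1}−q_x) + ½V(q_x−q_{x−1}) and BLR's
bond current j_b = −½(p_b+p_{b+1})V′(q_{b+1}−q_b) (one-variable derivs of polynomials). [difficulty:
provable-now] [BonettoLebowitzReyBellet2000, KunduDharNarayan2009]
#9 ParityStatics (support) — (the card's (S)(i),(iii): Euler block vanishes, contact damping
explicit; provable now) under gibbsMeasure N T (N ≥ 2): ∫ e_x j_b dμ = 0 for all x, b (momentum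
parity), and Cov(e_x, L e_y) = −γT²·[x = y ∈ {0, N−1}] (Gaussian fourth moment Var(p²) = 2T²;
Cov(e_x, j) = 0). [difficulty: provable-now] [BonettoLebowitzReyBellet2000, ChuLi2019]
#9 MemoryConductivity (support) — (conclusion node of the reduction; = clause (ii) in correlation
form) for all parameters > 0 and T > 0 there is k > 0 with ∫₀^∞corr(J,J) / (N − 1) → k as N → ∞ (the
equilibrium total-current autocorrelation integral of the N-chain with baths grows linearly with
slope k = T²κ(T)). Closed by NetworkReduction from the cruxes; stated alone so other lines
(abelian-squeeze, open-chain-mazur-bridge, contact-cross-correlation) can want the same decl; in the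
deciding theorem it is obtained as NetworkReduction applied to its six antecedents. [difficulty:
open-problem] [KunduDharNarayan2009, BonettoLebowitzReyBellet2000]
#9 NessUnique (support) — shared item stmt-AtomisticToContinuum-0741 (verbatim signature):
uniqueness of the weak steady state of pinnedChain (IsSteadyState class) for all N, T_L, T_R > 0;
hypothesis of OpenChainGreenKubo and, with the proved fact pinnedChain_exists_isSteadyState
(CuneoEckmannHairerReyBellet2018_pinnedChain_holds), clause (i) of FouriersLawFor in the deciding
theorem. [difficulty: M] [CuneoEckmannHairerReyBellet2018, Carmona2007]
#10 NetworkReduction (support) — (the deterministic reduction; card item DiscreteEllipticLimit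
restricted to κ) GeneratorSiteEnergy → ParityStatics → FeshbachIdentities → OrthogonalOhm →
PositiveMemory → RobinCoercivity → MemoryConductivity. Proof plan (finite-dimensional linear algebra
+ 1-D homogenisation, no dynamics): at fixed N and small s > 0, lap_s(J,J) = schur_s(J,J) −
m(s)ᵀ𝔽(s)⁻¹m(s) with 𝔽 = χG⁻¹χ symmetric positive definite (Θ-symmetry; FeshbachIdentities
(iii)–(iv)) and m_y(s) = schur_s(J, L e_y) = (ρ_{y−1}(s) − ρ_y(s)) + γ[y∈∂]schur_s(p_y², J)
(linearity + GeneratorSiteEnergy + parity); UPPER bound lap_s(J,J) ≤ schur_s(J,J) → Σ_bρ_b = (N−1)k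
+ o(N); LOWER bound mᵀ𝔽⁻¹m = max_ξ(2m·ξ − ξᵀ𝔽ξ) ≤ max_ξ(2m·ξ − c‖ξ‖²_Robin) = O(1) + c⁻¹Σ_b(ρ_b −
k)² = O(1) + o(N) because the Robin terms pin ξ_0, ξ_{N−1} to O(1); s ↓ 0 at fixed N first
(lap_s(J,J) → ∫₀^∞corr(J,J) by dominated convergence, FeshbachIdentities (i)), then N → ∞; k ≥ k₀ >
0 by PositiveMemory. Rank 10 so that the gate writes it after the decls it quotes. [difficulty: L]
[Zwanzig2001, KunduDharNarayan2009, ArmstrongKuusiMourrat2019]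

TWO-LAYER PLAN. Foreseen glued splits once staffed (nothing filed now, k ≤ 3, depth 1):
OrthogonalOhm ⇐ FixedNLap (existence of the s↓0 limits of schur_s on the current sector at each N,
fixed-N spectral theory of QLQ: no kernel of QLQ on Ran Q, from hypoellipticity at the baths) →
UniformLocality (summable off-diagonal decay of 𝔎_N(0)_{bb′} = schur_0(j_b,j_{b′}) and of the
contact rows, N-uniform) → BulkLimit (𝔎_N(0)_{bb′} → K_∞(b−b′) away from the ends, k = Σ_z K_∞(z)) →
OrthogonalOhm. RobinCoercivity ⇐ BulkEllipticity (symmetric part of 𝔎_N(s) ⪰ c·I on bond vectors,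
N-uniform) → ContactMargin (renormalised contact block ≥ c) → RobinCoercivity. PositiveMemory ⇐ a
Thomson/Dirichlet principle for the even–odd split of QLQ (import from card
even-parity-dirichlet-principle) → explicit trial current.

KILL CRITERIA. OrthogonalOhm refuted for pinnedChain at some T (ρ_b provably unbounded or drifting
in N while D_N stays bounded, or the s↓0 limit failing at fixed N for infinitely many N) closes the
route `refuted:OrthogonalOhm` — the Feshbach relocation of the difficulty was wrong. RobinCoercivity
refuted (super-diffusive time-integrated energy correlations at some T) forces a pivot to a weighted
/ averaged coercivity (tenure restate) or closes the line; PositiveMemory refuted means κ = 0 and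
refutes the conjunct itself (file ¬FouriersLaw). NetworkReduction or FeshbachIdentities refuted = a
missing hypothesis / misstatement in the fixed-N algebra: restate (tenure, class misstated), not
close. A proof of ¬HasBoundedResponse(pinnedChain) (hidden conserved charge) kills every FouriersLaw
line including this one. MemoryConductivity + OpenChainGreenKubo proved elsewhere (e.g. via
FourierGreenKubo's ThermodynamicLimit or OddSectorIrreversibility's corrector decay) moots the
cruxes but closes this route's target through the same `closes`.

NOT DECOMPOSED YET. The bond-resolved memory matrix 𝔎_N(s)_{bb′} and its bulk limit K_∞ (only the
row sums ρ_b are typed at open); the Weyl law for the slow spectrum (Conjecture W of card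
weyl-law-for-heat: small zeros of det 𝔽_N(s) at s = −(κ/c_v)π²k²/N², which needs continuation of
lap_s to Re s < 0 — a corollary, not needed for the conjunct); the PlateauLemma Σ_zK_∞(z) = T²κ_GK
linking to FourierGreenKubo's stmt-0742; T-dependence / continuity of k(T); the fixed-N
non-degeneracy lemmas (G(0⁺) invertible, ker QLQ ∩ Ran Q = 0) inside FeshbachIdentities / FixedNLap;
constants c, k₀ at low T (allowed to degenerate as T → 0, LowTemperatureWeakAnharmonicity).

CHEAPEST FALSIFIER. (1) ALGEBRA CHECK (numpy, minutes; kills misstatements, not the physics): for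
the Gaussian member pinnedChain ω₂ 0 0 γ, N = 2…8, compute corr, lap_s, G(s), schur_s, 𝔽_N(s)
exactly from Lyapunov/Sylvester equations and verify to machine precision 𝔽 = χG⁻¹χ, lap_s(J,J) =
schur_s(J,J) − mᵀ𝔽⁻¹m with m_y = schur_s(J, L e_y), and the Kolmogorov / time-reversal identities —
a sign or normalisation slip retires FeshbachIdentities / NetworkReduction AS TYPED (repair =
restate). (2) THE DISCRIMINATING TEST (kit MD, hours): equilibrium pinnedChain 1 1 1 1, T = 1, N ∈
{16, 32, 64}: estimate ρ_{N/2}(N) = lim_s schur_s(j_{N/2}, J) and the two contact rows from measured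
correlations (the energy block G(s) needs runs ≫ N²); D_N is numerically convergent for such chains,
so the EXTRA content of OrthogonalOhm is that ρ_{N/2} does not drift with N (schur − lap = mᵀ𝔽⁻¹m
stays O(1)); a linear drift kills the relocation while Fourier may still hold. The harmonic-chain
test proposed at gen-1 is NOT discriminating (rreview c3531e67: the ballistic ∫corr ~ N² forces ρ_b
unbounded there) and is dropped. Neither run here (no kit in the plancard budget).

NUMBERS. Local-kernel calibration of the exact circuit formula: ∫₀^∞corr(J,J) = (N−1)²/((N−1)/K +
2/(γT²)), i.e. J̃/δT = 1/((N−1)T²/K + 2/γ): bulk resistivity T²/K per bond, contact resistance 1/γ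
per bath (N−1 = 0 gives the exact single-site value γ/2); κ = K/T² = k/T². Phenomenology to match:
R_L = (L + 2εℓ)/κ (LepriLiviPoliti2003 §3.4). Harmonic member: D_N ~ N (HarmonicChainBallisticFlux),
λ_S ≤ γ/N (BeckerMenegaki2022_gapClosing, proved in tree). KDN normalisation checked on
arXiv:0809.4543 p. 3 (G = T⁻²∫⟨j̄(t)j̄(0)⟩, j̄ = J/(N−1)). Items at open: 11 (3 cruxes, 7 support, 1
assembly); deciding theorem 45 lines.

DEFINITION REQUESTS. None blocking: every statement is typed over existing declarations
(pinnedChain, OscillatorChain.gibbsMeasure, OscillatorChain.transitionKernel, generator,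
bondCurrent, totalCurrent, IsSteadyState, Matrix.inv). A tenure pass may request
`Summits/AtomisticToContinuum/FouriersLaw/Theorems` definitions equilibriumCorr / laplaceCorr /
orthogonalSchur (the three `let`-bound gadgets repeated in each decl) and restate the items through
them by set-signature; not filed now to keep the cone free of unlanded definitions.

Novelty: Searches (2026-08-15, this planner, on top of the card's, gen-1's and the novelty audit's): `lit
search --hybrid "Mori-Zwanzig projection operator heat conduction oscillator chain memory kernel
energy current"` (12 books: Zwanzig2001 pp. 87/152–153, Gaspard2022 §2.9.2 pp. 236–238 Mori
projection-operator method, Bismut hypoelliptic Laplacian — textbook derivations, no rigorous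
lattice result); `lit search --source crossref "projection operator memory kernel thermal
conductivity anharmonic chain generalized Langevin"` (15: Widder–Zimmer–Schilling 2025
doi:10.1088/1751-8121/ae02cc and Izvekov 2025 doi:10.1103/physreve.111.034130 on the GLE / Mori
technique in general, nothing for boundary-driven lattices); `lit galaxy search "Mori-Zwanzig
formalism" --star pdf` (20: coarse-graining, MZ modal decomposition arXiv:2311.09524, data-driven
closures — none on Fourier's law); `lit galaxy search "orthogonal dynamics memory kernel thermal
conductivity" --star all` and `"projection operator Fourier's law" --star all` (0 rows each); `lit
vsearch` of the thesis sentence (nearest: GustafsonSigal2003 Feshbach–Schur map chapter); `lit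
frontier AtomisticToContinuum --since 2023` (heat items: arXiv:2310.13338 Canestrari–Liverani–Olla,
arXiv:2604.14056 specific heat of driven chains — neither projects onto energy profiles); `lit read
arXiv:0809.4543` p. 3 (KDN normalisation); openalex tier HTTP 429 (budget), arxiv/zbmath 0 rows —
recorded, not worked around; `ledger negatives --problem Atomistic  [refs: 10.1088/1751-8121/ae02cc, 10.1103/physreve.111.034130, 10.4310/cms.2019.v17.n2.a10, 2311.09524, 2310.13338, 2604.14056, 0809.4543, 1709.05928, 1102.3831, doi:10.1088/1751-8121/ae02cc, doi:10.1103/physreve.111.034130, doi:10.4310/cms.2019.v17.n2.a10, Zwanzig2001, Gaspard2022, GustafsonSigal2003, ChuLi2019, BricmontKupiainen2013, KunduDharNarayan2009, BachFrohlichSigal1998]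

Barriers (technique_class: feshbach-schur-slow-subspace, orthogonal-dynamics-lap): - technique_class: feshbach-schur-slow-subspace, orthogonal-dynamics-lap
- Literature.Barriers.AtomisticToContinuum.BeckerMenegaki2022_gapClosing: EMBRACED — no N-uniform
rate or gap of L_N is used; the N slow directions whose rates close (≲ N⁻²; γ/N proved) are exactly
Ran P, removed by the Schur complement; the cruxes ask regularity of the ORTHOGONAL resolvent at s ≈
0 tested on currents and coercivity of the complement, both compatible with a closing gap. Honest
caveat: QLQ is still skew + rank-2 dissipation, so its own spectrum also approaches the imaginary
axis; the bet is that at zero frequency in the odd/current sector the pinning gap and CLT-small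
two-diffuson vertices leave a limiting absorption principle.
- Literature.Barriers.AtomisticToContinuum.equilibrium_rate_bound: same class (N-uniform equilibrium
rates); not used — only time-INTEGRATED correlations at fixed N and their Schur complements enter.
- Literature.Barriers.AtomisticToContinuum.HasBoundedResponse: not evaded, LOCALISED — by
OpenChainGreenKubo + (lap(J,J) ≤ schur(J,J)) it is implied by sup_N sup_b |ρ_b| < ∞, the boundedness
clause of OrthogonalOhm (finite local Ohmic conductivity of the orthogonal dynamics);
hasBoundedResponse_of_fouriersLawFor (proved) says every line must pay this, and the crux docstring
says so.
- Literature.Barriers.AtomisticToContinuum.HarmonicChainBallisticFlux: consistent — for lam = β = 0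
the reduction is still exact, so not_hasBoundedResponse forces OrthogonalOhm (bounded ρ_b

History (route lifecycle, newest last):
- 2026-08-26T06:32:50Z · DORMANT — reconciler: no traction for 8.4 d (last activity item-evidence-added at 2026-08-17T20:58:21Z); parked, not closed — `ledger route dormant route-AtomisticToConti (operator:999:305698)

sub-problem: FouriersLaw · status: dormant · opened planner-plancard-AtomisticToContinuum-Fourier-cd83d032-g2-0 2026-08-15T18:56:08Z · rev 0 · ledger route-AtomisticToContinuum-HonestZwanzig
GENERATED by the gate from the ledger (D-0016/17). Provers cite these decls: `theorem foo : Summit.AtomisticToContinuum.FouriersLaw.Theses.HonestZwanzig.<Decl> := …` in Summits/AtomisticToContinuum/FouriersLaw/Theorems/<Name>.lean.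
-/

namespace Summit.AtomisticToContinuum.FouriersLaw.Theses.HonestZwanzig

open scoped BigOperators Topology Manifold Classical MeasureTheory ProbabilityTheory Matrix InnerProductSpace ComplexConjugate ContinuousMap
open Filter Set Function TopologicalSpace MeasureTheory

attribute [summit_statement] _root_.FouriersLaw

/-- item stmt-AtomisticToContinuum-12693 · crux · rank 2 · open · by planner
why it might fail: Σ_bρ_b ≥ (N−1)T²D_N, so |ρ_b| ≤ C already contains HasBoundedResponse; a Drude pole may survive in QLQ (harmonic: ρ_b ~ N; hidden odd charge, Mazur), or two-diffuson modes ẽẽ ∈ Ran Q (rates ~N⁻²) keep non-O(1/N) residues so ρ_b drifts with N; compacts of T>0 only.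
sources: Zwanzig2001, KunduDharNarayan2009, BonettoLebowitzReyBellet2000, BeckerMenegaki2022, ChuLi2019, HairerMattingly2009
[crux] (card item (C) MemoryRegularity, in Schur-complement form) for pinnedChain (all parameters >
0) and T > 0 there are k, C such that for every ε > 0 there is R with: for all N ≥ 2 and every bond
b, the orthogonal-dynamics DC response ρ_b = lim_{s↓0} schur_s(j_b, J) exists (limiting absorption
at zero frequency in the current sector), |ρ_b| ≤ C, and |ρ_b − k| ≤ ε whenever b is at distance ≥ R
from both ends (local Ohm law of the orthogonal dynamics, homogeneous in the bulk); and the two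
contact responses lim_{s↓0} schur_s(p_b², J), b ∈ {0, N−1}, exist with modulus ≤ C. Since
schur_s(J,J) ≥ lap_s(J,J) (time reversal), Σ_b ρ_b ≥ (N−1)T²D_N: the boundedness clause is at least
HasBoundedResponse (refuter remark, recorded). [difficulty: open-problem] -/
@[route_item "route-AtomisticToContinuum-HonestZwanzig", crux]
def OrthogonalOhm : Prop :=
  ∀ ω₂ lam β γ : ℝ, 0 < ω₂ → 0 < lam → 0 < β → 0 < γ → ∀ T : ℝ, 0 < T → ∃ k C : ℝ, ∀ ε : ℝ, 0 < ε → ∃ R : ℕ, ∀ N : ℕ, 2 ≤ N → let P := Literature.MathematicalPhysics.KineticTheory.HeatConduction.pinnedChain ω₂ lam β γ; let X := Literature.MathematicalPhysics.KineticTheory.HeatConduction.PhaseSpace N; let μ : MeasureTheory.Measure X := P.gibbsMeasure N T; let corr : (X → ℝ) → (X → ℝ) → ℝ → ℝ := fun f g t => (∫ z, f z * (∫ y, g y ∂(P.transitionKernel N T T t.toNNReal z)) ∂μ) - (∫ z, f z ∂μ) * (∫ z, g z ∂μ); let lap : ℝ → (X → ℝ) → (X → ℝ) → ℝ := fun s f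 g => ∫ t in Set.Ioi (0 : ℝ), Real.exp (-(s * t)) * corr f g t; let e : Fin N → X → ℝ := fun x z => z.2 x ^ 2 / 2 + P.U (z.1 x) + ∑ j : Fin N, ((if j.val = x.val + 1 then P.V (z.1 j - z.1 x) / 2 else 0) + (if x.val = j.val + 1 then P.V (z.1 x - z.1 j) / 2 else 0)); let G : ℝ → Matrix (Fin N) (Fin N) ℝ := fun s => Matrix.of fun x y => lap s (e x) (e y); let schur : ℝ → (X → ℝ) → (X → ℝ) → ℝ := fun s f g => lap s f g - ∑ x : Fin N, ∑ y : Fin N, lap s f (e x) * (G s)⁻¹ x y * lap s (e y) g; let J : X → ℝ := fun z => ∑ i : Fin N, P.bondCurrent N i z; (∀ b : Fin N, b.val + 1 < N → ∃ ρ : ℝ, Filter.Tendsto (fun s => schur s (P.bondCurrent N b) J) (nhdsWithin (0 : ℝ) (Set.Ioi 0)) (nhds ρ) ∧ |ρ| ≤ C ∧ (R ≤ b.val → b.val + 2 + R ≤ N → |ρ - k| ≤ ε)) ∧ (∀ b : Fin N, (b.val = 0 ∨ b.val = N - 1) → ∃ w : ℝ, Filter.Tendsto (fun s => schur s (fun z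 => z.2 b ^ 2) J) (nhdsWithin (0 : ℝ) (Set.Ioi 0)) (nhds w) ∧ |w| ≤ C)

/-- item stmt-AtomisticToContinuum-12694 · crux · rank 3 · open · by planner
why it might fail: No Thomson-type lower bound is known for the NON-reversible projected resolvent; ρ_b could tend to 0 if bond currents were asymptotically QLQ-coboundaries (orthogonal dynamics insulating) — absurd for a clean chain but unproved; low T makes k₀(T) ~ (lam T)⁻²-scale delicate.
sources: BonettoLebowitzReyBellet2000, Zwanzig2001, LandimMarianiSeo2018, AokiLukkarinenSpohn2006
[crux] (card item PositiveSymbol) for pinnedChain (all > 0) and T > 0 there are k₀ > 0 and R such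
that for all N ≥ 2 and every bulk bond b (distance ≥ R from both ends), any limit ρ_b = lim_{s↓0}
schur_s(j_b, J) satisfies ρ_b ≥ k₀ — the orthogonal dynamics is not an insulator; k₀ is a
T⁻²-normalised lower bound for κ. [deps: OrthogonalOhm] [difficulty: L] -/
@[route_item "route-AtomisticToContinuum-HonestZwanzig", crux]
def PositiveMemory : Prop :=
  ∀ ω₂ lam β γ : ℝ, 0 < ω₂ → 0 < lam → 0 < β → 0 < γ → ∀ T : ℝ, 0 < T → ∃ k₀ : ℝ, 0 < k₀ ∧ ∃ R : ℕ, ∀ N : ℕ, 2 ≤ N → let P := Literature.MathematicalPhysics.KineticTheory.HeatConduction.pinnedChain ω₂ lam β γ; let X := Literature.MathematicalPhysics.KineticTheory.HeatConduction.PhaseSpace N; let μ : MeasureTheory.Measure X := P.gibbsMeasure N T; let corr : (X → ℝ) → (X → ℝ) → ℝ → ℝ := fun f g t => (∫ z, f z * (∫ y, g y ∂(P.transitionKernel N T T t.toNNReal z)) ∂μ) - (∫ z, f z ∂μ) * (∫ z, g z ∂μ); let lap : ℝ → (X → ℝ) → (X → ℝ) → ℝ := fun s f g => ∫ t in Set.Ioi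 (0 : ℝ), Real.exp (-(s * t)) * corr f g t; let e : Fin N → X → ℝ := fun x z => z.2 x ^ 2 / 2 + P.U (z.1 x) + ∑ j : Fin N, ((if j.val = x.val + 1 then P.V (z.1 j - z.1 x) / 2 else 0) + (if x.val = j.val + 1 then P.V (z.1 x - z.1 j) / 2 else 0)); let G : ℝ → Matrix (Fin N) (Fin N) ℝ := fun s => Matrix.of fun x y => lap s (e x) (e y); let schur : ℝ → (X → ℝ) → (X → ℝ) → ℝ := fun s f g => lap s f g - ∑ x : Fin N, ∑ y : Fin N, lap s f (e x) * (G s)⁻¹ x y * lap s (e y) g; let J : X → ℝ := fun z => ∑ i : Fin N, P.bondCurrent N i z; ∀ b : Fin N, R ≤ b.val → b.val + 2 + R ≤ N → ∀ ρ : ℝ, Filter.Tendsto (fun s => schur s (P.bondCurrent N b) J) (nhdsWithin (0 : ℝ) (Set.Ioi 0)) (nhds ρ) → k₀ ≤ ρ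

/-- item stmt-AtomisticToContinuum-12695 · crux · rank 4 · open · by planner
why it might fail: Long-lived localised nonlinear excitations in the bulk (breathers / hot spots; cf. Hairer–Mattingly slow relaxation when pinning dominates) could make time-integrated energy autocorrelations super-diffusive (≫ N), or the renormalised contact conductance γT² − γ²⟨w_b,R_Q w_b⟩ could degenerate with N.
sources: HairerMattingly2009, CuneoEckmannHairerReyBellet2018, BeckerMenegaki2022, Zwanzig2001, Dhar2008
[crux] (the card's "discrete Robin heat operator", made quantitative) for pinnedChain (all > 0) and
T > 0 there is c > 0 such that for every N ≥ 2 there is s₀ > 0 with: for 0 < s < s₀ and every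
profile ξ ∈ ℝ^N, ξᵀ𝔽_N(s)ξ ≥ c·(Σ_b (ξ_{b+1} − ξ_b)² + ξ_0² + ξ_{N−1}²), where 𝔽_N(s)_{xy} =
s·Cov(e_x,e_y) − Cov(e_x, L e_y) − schur_s(L†e_x, L e_y) with L†e_x = (L e_x)∘(p ↦ −p) — uniform
ellipticity (with Robin ends) of the Feshbach–Schur complement of s − L_N on the energy profiles;
equivalently ∫₀^∞Cov(Σa_xe_x, Σa_xe_x(t))dt ≤ c⁻¹ aᵀχ(Δ_N + E_∂)⁻¹χa: time-integrated energy
fluctuations relax at least as fast as a Robin heat flow. [difficulty: open-problem] -/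
@[route_item "route-AtomisticToContinuum-HonestZwanzig", crux]
def RobinCoercivity : Prop :=
  ∀ ω₂ lam β γ : ℝ, 0 < ω₂ → 0 < lam → 0 < β → 0 < γ → ∀ T : ℝ, 0 < T → ∃ c : ℝ, 0 < c ∧ ∀ N : ℕ, 2 ≤ N → ∃ s₀ : ℝ, 0 < s₀ ∧ let P := Literature.MathematicalPhysics.KineticTheory.HeatConduction.pinnedChain ω₂ lam β γ; let X := Literature.MathematicalPhysics.KineticTheory.HeatConduction.PhaseSpace N; let μ : MeasureTheory.Measure X := P.gibbsMeasure N T; let corr : (X → ℝ) → (X → ℝ) → ℝ → ℝ := fun f g t => (∫ z, f z * (∫ y, g y ∂(P.transitionKernel N T T t.toNNReal z)) ∂μ) - (∫ z, f z ∂μ) * (∫ z, g z ∂μ); let lap : ℝ → (X → ℝ) → (X → ℝ) → ℝ := fun s f g => ∫ t in Set.Ioi (0 : ℝ), Real.exp (-(s * t)) * corr f g t; let cov : (X → ℝ) → (X → ℝ) → ℝ := fun f g => (∫ z, f z * g z ∂μ) - (∫ z, f z ∂μ) * (∫ z, g z ∂μ); let e : Fin N → X → ℝ := fun x z => z.2 x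 ^ 2 / 2 + P.U (z.1 x) + ∑ j : Fin N, ((if j.val = x.val + 1 then P.V (z.1 j - z.1 x) / 2 else 0) + (if x.val = j.val + 1 then P.V (z.1 x - z.1 j) / 2 else 0)); let G : ℝ → Matrix (Fin N) (Fin N) ℝ := fun s => Matrix.of fun x y => lap s (e x) (e y); let schur : ℝ → (X → ℝ) → (X → ℝ) → ℝ := fun s f g => lap s f g - ∑ x : Fin N, ∑ y : Fin N, lap s f (e x) * (G s)⁻¹ x y * lap s (e y) g; let F : ℝ → Fin N → Fin N → ℝ := fun s x y => s * cov (e x) (e y) - cov (e x) (P.generator N T T (e y)) - schur s (fun z => P.generator N T T (e x) (z.1, -z.2)) (P.generator N T T (e y)); ∀ s : ℝ, 0 < s → s < s₀ → ∀ ξ : Fin N → ℝ, c * (∑ i : Fin N, ((∑ j : Fin N, if j.val = i.val + 1 then (ξ j - ξ i) ^ 2 else 0) + (if i.val = 0 then ξ i ^ 2 else 0) + (if i.val = N - 1 then ξ i ^ 2 else 0))) ≤ ∑ x : Fin N, ∑ y : Fin N, ξ x * F s x y * ξ y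

/-- item stmt-AtomisticToContinuum-0741 · support · rank 9 · closed · proved by Summit.AtomisticToContinuum.FouriersLaw.Theorems.nessUnique_proof (prover) · by planner
sources: CuneoEckmannHairerReyBellet2018, Carmona2007
[crux] UNIQUENESS OF THE WEAK STEADY STATE (the half of stmt-0706 not covered by the landed fact
Literature.MathematicalPhysics.KineticTheory.HeatConduction.CuneoEckmannHairerReyBellet2018_pinnedChain,
p3544): for pinnedChain ω₂ lam β γ (all > 0), every N and T_L, T_R > 0, any two measures in the weak
Fokker–Planck class IsSteadyState (probability, ∫ L f dμ = 0 for f ∈ C_c^∞, bond currents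
integrable) coincide. Print: uniqueness of the INVARIANT MEASURE of the Langevin semigroup
(CuneoEckmannHairerReyBellet2018 Thm 2.13(1): C1, C2, CA; Carmona2007 Thm 1.1(iii)); the item
additionally needs 'weak stationary probability solution of L*μ = 0 ⇒ P_t-invariant' for this
hypoelliptic L with cubic drift (Echeverría 1982 well-posed martingale problem on C_c^∞ +
non-explosion via e^{θH}; Bogachev–Krylov–Röckner–Shaposhnikov 2015 Ch. 5 is non-degenerate only) —
the FP-identification lemma is the formal crux. N = 0: PhaseSpace 0 is a point (unique probability
measure); N = 1: both baths on site 0, OU at temperature (T_L+T_R)/2. This is exactly the hypothesis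
of FiniteResponse and ThermodynamicLimit and, with the fact, gives clause (i) of FouriersLawFor. -/
@[route_item "route-AtomisticToContinuum-HonestZwanzig", crux]
def NessUnique : Prop :=
  ∀ ω₂ lam β γ : ℝ, 0 < ω₂ → 0 < lam → 0 < β → 0 < γ → ∀ (N : ℕ) (T_L T_R : ℝ), 0 < T_L → 0 < T_R → ∀ μ ν : MeasureTheory.Measure (Literature.MathematicalPhysics.KineticTheory.HeatConduction.PhaseSpace N), (Literature.MathematicalPhysics.KineticTheory.HeatConduction.pinnedChain ω₂ lam β γ).IsSteadyState N T_L T_R μ → (Literature.MathematicalPhysics.KineticTheory.HeatConduction.pinnedChain ω₂ lam β γ).IsSteadyState N T_L T_R ν → μ = ν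

/-- `NessUnique` holds: proved by `Summit.AtomisticToContinuum.FouriersLaw.Theorems.nessUnique_proof`. -/
theorem NessUnique_holds : NessUnique := _root_.Summit.AtomisticToContinuum.FouriersLaw.Theorems.nessUnique_proof

/-- item stmt-AtomisticToContinuum-12696 · support · rank 9 · closed · proved by Summit.AtomisticToContinuum.FouriersLaw.Theorems.OddSectorIrreversibility.Corrector.openChainGreenKubo_holds (prover) · by planner
sources: KunduDharNarayan2009, BonettoLebowitzReyBellet2000, ReyBellet2003, HairerMajda2009, CuneoEckmannHairerReyBellet2018
[support] (Kundu–Dhar–Narayan open-system Green–Kubo identity, typed over the canonical objects)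
under weak-NESS uniqueness, for every steady-state family, T > 0 and N ≥ 2: t ↦ corr(J,J)(t) is
integrable on (0,∞) and the clause-(ii) response limit exists and equals D_N =
∫₀^∞corr(J,J)/((N−1)T²) (KDN, arXiv:0809.4543 p. 3: conductance G = (1/T²)∫⟨j̄(t)j̄(0)⟩, j̄ =
J/(N−1); our D_N = (N−1)·J̃/δT = (N−1)G). Physics-level in print for Langevin baths (BLR: "(32) has
not been proved"); rigorous route: Hairer–Majda differentiability of the NESS at equilibrium + KDN's
Novikov / time-reversal / continuity-equation steps; supplies FiniteResponse (stmt-0717) for N ≥ 2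
as a by-product; it is a hypothesis of the deciding theorem. [difficulty: L] -/
@[route_item "route-AtomisticToContinuum-HonestZwanzig", crux]
def OpenChainGreenKubo : Prop :=
  ∀ ω₂ lam β γ : ℝ, 0 < ω₂ → 0 < lam → 0 < β → 0 < γ → (∀ (N : ℕ) (T_L T_R : ℝ), 0 < T_L → 0 < T_R → ∀ μ ν : MeasureTheory.Measure (Literature.MathematicalPhysics.KineticTheory.HeatConduction.PhaseSpace N), (Literature.MathematicalPhysics.KineticTheory.HeatConduction.pinnedChain ω₂ lam β γ).IsSteadyState N T_L T_R μ → (Literature.MathematicalPhysics.KineticTheory.HeatConduction.pinnedChain ω₂ lam β γ).IsSteadyState N T_L T_R ν → μ = ν) → ∀ μf : (N : ℕ) → ℝ → ℝ → MeasureTheory.Measure (Literature.MathematicalPhysics.KineticTheory.HeatConduction.PhaseSpace N), (∀ (N : ℕ) (T_L T_R : ℝ), 0 < T_L → 0 < T_R → (Literature.MathematicalPhysics.KineticTheory.HeatConduction.pinnedChain ω₂ lam β γ).IsSteadyState N T_L T_R (μf N T_L T_R)) → ∀ T : ℝ, 0 < T → ∀ N : ℕ, 2 ≤ N → let P := Literature.MathematicalPhysics.KineticTheory.HeatConduction.pinnedChain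 ω₂ lam β γ; let X := Literature.MathematicalPhysics.KineticTheory.HeatConduction.PhaseSpace N; let μ : MeasureTheory.Measure X := P.gibbsMeasure N T; let J : X → ℝ := fun z => ∑ i : Fin N, P.bondCurrent N i z; let corrJJ : ℝ → ℝ := fun t => (∫ z, J z * (∫ y, J y ∂(P.transitionKernel N T T t.toNNReal z)) ∂μ) - (∫ z, J z ∂μ) * (∫ z, J z ∂μ); MeasureTheory.IntegrableOn corrJJ (Set.Ioi 0) ∧ Filter.Tendsto (fun δ : ℝ => P.totalCurrent (μf N (T + δ / 2) (T - δ / 2)) / δ) (nhdsWithin 0 {(0 : ℝ)}ᶜ) (nhds ((∫ t in Set.Ioi (0 : ℝ), corrJJ t) / (((N : ℝ) - 1) * T ^ 2)))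

-- `OpenChainGreenKubo` holds: proved by `Summit.AtomisticToContinuum.FouriersLaw.Theorems.OddSectorIrreversibility.Corrector.openChainGreenKubo_holds` (its module imports this route file, so no `_holds` link can be stated here).

/-- item stmt-AtomisticToContinuum-12697 · support · rank 9 · closed · proved by Summit.AtomisticToContinuum.FouriersLaw.Theorems.HonestZwanzig.Robin.stub_feshbachIdentities (prover) · by planner
sources: CuneoEckmannHairerReyBellet2018, KunduDharNarayan2009, Zwanzig2001, GivonKupfermanStuart2004
[support] (fixed-N package behind the Feshbach block algebra, for the constructed equilibrium
semigroup) for N ≥ 2, T > 0: (0) the Gibbs measure is invariant under the transition kernels; for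
observables f, g continuous with |f|,|g| ≤ A·e^{H/(8T)}: (i) f and f·(P_t g) are μ-integrable and
corr(f,g) ∈ L¹(0,∞) (fixed-N exponential mixing, CEHR Thm 2.13(3)); (ii) time reversal corr(f,g)(t)
= corr(g∘Θ, f∘Θ)(t), Θ(q,p) = (q,−p) (detailed balance); (iii) the Kolmogorov identities
s·lap_s(e_x,g) − Cov(e_x,g) = lap_s((Le_x)∘Θ, g) and s·lap_s(f,e_x) − Cov(f,e_x) = lap_s(f, Le_x);
(iv) Cov(e,e) and G(s) (s > 0) are positive definite. From these the prover of NetworkReduction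
derives 𝔽 = χG⁻¹χ and lap_s(J,J) = schur_s(J,J) − mᵀ𝔽⁻¹m by finite-dimensional linear algebra
(re-derived by this planner, NOTES.md). [difficulty: L] -/
@[route_item "route-AtomisticToContinuum-HonestZwanzig", crux]
def FeshbachIdentities : Prop :=
  ∀ ω₂ lam β γ : ℝ, 0 < ω₂ → 0 < lam → 0 < β → 0 < γ → ∀ T : ℝ, 0 < T → ∀ N : ℕ, 2 ≤ N → let P := Literature.MathematicalPhysics.KineticTheory.HeatConduction.pinnedChain ω₂ lam β γ; let X := Literature.MathematicalPhysics.KineticTheory.HeatConduction.PhaseSpace N; let μ : MeasureTheory.Measure X := P.gibbsMeasure N T; let corr : (X → ℝ) → (X → ℝ) → ℝ → ℝ := fun f g t => (∫ z, f z * (∫ y, g y ∂(P.transitionKernel N T T t.toNNReal z)) ∂μ) - (∫ z, f z ∂μ) * (∫ z, g z ∂μ); let lap : ℝ → (X → ℝ) → (X → ℝ) → ℝ := fun s f g => ∫ t in Set.Ioi (0 : ℝ), Real.exp (-(s * t)) * corr f g t; let cov : (X → ℝ) → (X → ℝ) → ℝ := fun f g => (∫ z, f z * g z ∂μ) - (∫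 z, f z ∂μ) * (∫ z, g z ∂μ); let e : Fin N → X → ℝ := fun x z => z.2 x ^ 2 / 2 + P.U (z.1 x) + ∑ j : Fin N, ((if j.val = x.val + 1 then P.V (z.1 j - z.1 x) / 2 else 0) + (if x.val = j.val + 1 then P.V (z.1 x - z.1 j) / 2 else 0)); let G : ℝ → Matrix (Fin N) (Fin N) ℝ := fun s => Matrix.of fun x y => lap s (e x) (e y); let Adm : (X → ℝ) → Prop := fun f => Continuous f ∧ ∃ A : ℝ, ∀ z, |f z| ≤ A * Real.exp (P.hamiltonian N z / (8 * T)); (∀ t : ℝ, 0 ≤ t → μ.bind (fun z => P.transitionKernel N T T t.toNNReal z) = μ) ∧ (∀ f g : X → ℝ, Adm f → Adm g → MeasureTheory.Integrable f μ ∧ (∀ t : ℝ, 0 ≤ t → MeasureTheory.Integrable (fun z => f z * (∫ y, g y ∂(P.transitionKernel N T T t.toNNReal z))) μ) ∧ MeasureTheory.IntegrableOn (corr f g) (Set.Ioi 0) ∧ (∀ t : ℝ, 0 ≤ t → corr f g t = corr (fun z => g (z.1, -z.2)) (fun z => f (z.1, -z.2)) t) ∧ (∀ s : ℝ, 0 <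 s → ∀ x : Fin N, s * lap s (e x) g - cov (e x) g = lap s (fun z => P.generator N T T (e x) (z.1, -z.2)) g ∧ s * lap s f (e x) - cov f (e x) = lap s f (P.generator N T T (e x)))) ∧ (∀ ξ : Fin N → ℝ, ξ ≠ 0 → 0 < ∑ x : Fin N, ∑ y : Fin N, ξ x * cov (e x) (e y) * ξ y) ∧ (∀ s : ℝ, 0 < s → ∀ ξ : Fin N → ℝ, ξ ≠ 0 → 0 < ∑ x : Fin N, ∑ y : Fin N, ξ x * G s x y * ξ y)

-- `FeshbachIdentities` holds: proved by `Summit.AtomisticToContinuum.FouriersLaw.Theorems.HonestZwanzig.Robin.stub_feshbachIdentities` (its module imports this route file, so no `_holds` link can be stated here).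

/-- item stmt-AtomisticToContinuum-12698 · support · rank 9 · closed · proved by Summit.AtomisticToContinuum.FouriersLaw.Theorems.HonestZwanzig.generatorSiteEnergy_proof (prover) · by planner
sources: BonettoLebowitzReyBellet2000, KunduDharNarayan2009
[support] (structural lemma QLẽ = ∇·j, provable now) for N ≥ 2 and every site x: L e_x = j_{x−1} −
j_x + [x=0]γ(T_L − p_0²) + [x=N−1]γ(T_R − p_{N−1}²) pointwise, for the symmetrically split site
energy e_x = p_x²/2 + U(q_x) + ½V(q_{x+1}−q_x) + ½V(q_x−q_{x−1}) and BLR's bond current j_b =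
−½(p_b+p_{b+1})V′(q_{b+1}−q_b) (one-variable derivs of polynomials). [difficulty: provable-now] -/
@[route_item "route-AtomisticToContinuum-HonestZwanzig", crux]
def GeneratorSiteEnergy : Prop :=
  ∀ ω₂ lam β γ : ℝ, ∀ N : ℕ, 2 ≤ N → ∀ T_L T_R : ℝ, ∀ x : Fin N, ∀ z : Literature.MathematicalPhysics.KineticTheory.HeatConduction.PhaseSpace N, let P := Literature.MathematicalPhysics.KineticTheory.HeatConduction.pinnedChain ω₂ lam β γ; P.generator N T_L T_R (fun w => w.2 x ^ 2 / 2 + P.U (w.1 x) + ∑ j : Fin N, ((if j.val = x.val + 1 then P.V (w.1 j - w.1 x) / 2 else 0) + (if x.val = j.val + 1 then P.V (w.1 x - w.1 j) / 2 else 0))) z = (∑ b : Fin N, ((if x.val = b.val + 1 then P.bondCurrent N b z else 0) - (if b = x then P.bondCurrent N b z else 0))) + (if x.val = 0 then P.γ * (T_L - z.2 x ^ 2) else 0) + (if x.val = N - 1 then P.γ * (T_R - z.2 x ^ 2) else 0)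

-- `GeneratorSiteEnergy` holds: proved by `Summit.AtomisticToContinuum.FouriersLaw.Theorems.HonestZwanzig.generatorSiteEnergy_proof` (its module imports this route file, so no `_holds` link can be stated here).

/-- item stmt-AtomisticToContinuum-12699 · support · rank 9 · closed · proved by Summit.AtomisticToContinuum.FouriersLaw.Theorems.HonestZwanzig.parityStatics_proof (prover) · by planner
sources: BonettoLebowitzReyBellet2000, ChuLi2019
[support] (the card's (S)(i),(iii): Euler block vanishes, contact damping explicit; provable now)
under gibbsMeasure N T (N ≥ 2): ∫ e_x j_b dμ = 0 for all x, b (momentum parity), and Cov(e_x, L e_y)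
= −γT²·[x = y ∈ {0, N−1}] (Gaussian fourth moment Var(p²) = 2T²; Cov(e_x, j) = 0). [difficulty:
provable-now] -/
@[route_item "route-AtomisticToContinuum-HonestZwanzig", crux]
def ParityStatics : Prop :=
  ∀ ω₂ lam β γ : ℝ, 0 < ω₂ → 0 < lam → 0 < β → 0 < γ → ∀ T : ℝ, 0 < T → ∀ N : ℕ, 2 ≤ N → let P := Literature.MathematicalPhysics.KineticTheory.HeatConduction.pinnedChain ω₂ lam β γ; let X := Literature.MathematicalPhysics.KineticTheory.HeatConduction.PhaseSpace N; let μ : MeasureTheory.Measure X := P.gibbsMeasure N T; let e : Fin N → X → ℝ := fun x z => z.2 x ^ 2 / 2 + P.U (z.1 x) + ∑ j : Fin N, ((if j.val = x.val + 1 then P.V (z.1 j - z.1 x) / 2 else 0) + (if x.val = j.val + 1 then P.V (z.1 x - z.1 j) / 2 else 0)); ∀ x : Fin N, (∀ b : Fin N, ∫ z, e x z * P.bondCurrent N b z ∂μ = 0) ∧ ∀ y : Fin N, (∫ z, e x z * P.generator N T T (e y) z ∂μ) - (∫ z, e x z ∂μ) * (∫ z, P.generator N T T (e y) z ∂μ)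 = -(if x = y ∧ (x.val = 0 ∨ x.val = N - 1) then P.γ * T ^ 2 else 0)

-- `ParityStatics` holds: proved by `Summit.AtomisticToContinuum.FouriersLaw.Theorems.HonestZwanzig.parityStatics_proof` (its module imports this route file, so no `_holds` link can be stated here).

/-- item stmt-AtomisticToContinuum-12700 · support · rank 9 · open · by planner
sources: KunduDharNarayan2009, BonettoLebowitzReyBellet2000
[support] (conclusion node of the reduction; = clause (ii) in correlation form) for all parameters >
0 and T > 0 there is k > 0 with ∫₀^∞corr(J,J) / (N − 1) → k as N → ∞ (the equilibrium total-current
autocorrelation integral of the N-chain with baths grows linearly with slope k = T²κ(T)). Closed by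
NetworkReduction from the cruxes; stated alone so other lines (abelian-squeeze,
open-chain-mazur-bridge, contact-cross-correlation) can want the same decl; in the deciding theorem
it is obtained as NetworkReduction applied to its six antecedents. [difficulty: open-problem] -/
@[route_item "route-AtomisticToContinuum-HonestZwanzig", crux]
def MemoryConductivity : Prop :=
  ∀ ω₂ lam β γ : ℝ, 0 < ω₂ → 0 < lam → 0 < β → 0 < γ → ∀ T : ℝ, 0 < T → ∃ k : ℝ, 0 < k ∧ Filter.Tendsto (fun N : ℕ => (let P := Literature.MathematicalPhysics.KineticTheory.HeatConduction.pinnedChain ω₂ lam β γ; let X := Literature.MathematicalPhysics.KineticTheory.HeatConduction.PhaseSpace N; let μ : MeasureTheory.Measure X := P.gibbsMeasure N T; let J : X → ℝ := fun z => ∑ i : Fin N, P.bondCurrent N i z; (∫ t in Set.Ioi (0 : ℝ), ((∫ z, J z * (∫ y, J y ∂(P.transitionKernel N T T t.toNNReal z)) ∂μ) - (∫ z, J z ∂μ) * (∫ z, J z ∂μ))) / ((N : ℝ) - 1))) Filter.atTop (nhds k)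

/-- item stmt-AtomisticToContinuum-12701 · support · rank 10 · closed · proved by Summit.AtomisticToContinuum.FouriersLaw.Theorems.HonestZwanzig.NetworkReduction.networkReduction_proof (prover) · by planner
sources: Zwanzig2001, KunduDharNarayan2009, ArmstrongKuusiMourrat2019
[support] (the deterministic reduction; card item DiscreteEllipticLimit restricted to κ)
GeneratorSiteEnergy → ParityStatics → FeshbachIdentities → OrthogonalOhm → PositiveMemory →
RobinCoercivity → MemoryConductivity. Proof plan (finite-dimensional linear algebra + 1-D
homogenisation, no dynamics): at fixed N and small s > 0, lap_s(J,J) = schur_s(J,J) −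
m(s)ᵀ𝔽(s)⁻¹m(s) with 𝔽 = χG⁻¹χ symmetric positive definite (Θ-symmetry; FeshbachIdentities
(iii)–(iv)) and m_y(s) = schur_s(J, L e_y) = (ρ_{y−1}(s) − ρ_y(s)) + γ[y∈∂]schur_s(p_y², J)
(linearity + GeneratorSiteEnergy + parity); UPPER bound lap_s(J,J) ≤ schur_s(J,J) → Σ_bρ_b = (N−1)k
+ o(N); LOWER bound mᵀ𝔽⁻¹m = max_ξ(2m·ξ − ξᵀ𝔽ξ) ≤ max_ξ(2m·ξ − c‖ξ‖²_Robin) = O(1) + c⁻¹Σ_b(ρ_b −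
k)² = O(1) + o(N) because the Robin terms pin ξ_0, ξ_{N−1} to O(1); s ↓ 0 at fixed N first
(lap_s(J,J) → ∫₀^∞corr(J,J) by dominated convergence, FeshbachIdentities (i)), then N → ∞; k ≥ k₀ >
0 by PositiveMemory. Rank 10 so that the gate writes it after the decls it quotes. [difficulty: L] -/
@[route_item "route-AtomisticToContinuum-HonestZwanzig", crux]
def NetworkReduction : Prop :=
  GeneratorSiteEnergy → ParityStatics → FeshbachIdentities → OrthogonalOhm → PositiveMemory → RobinCoercivity → MemoryConductivity

-- `NetworkReduction` holds: proved by `Summit.AtomisticToContinuum.FouriersLaw.Theorems.HonestZwanzig.NetworkReduction.networkReduction_proof` (its module imports this route file, so no `_holds` link can be stated here).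

/-- item stmt-AtomisticToContinuum-12702 · assembly · rank 1 · closed · proved by Summit.AtomisticToContinuum.FouriersLaw.Theorems.honestZwanzig_assembly_proof @ f6d596a325fc (prover) · by planner
sources: BonettoLebowitzReyBellet2000, KunduDharNarayan2009, CuneoEckmannHairerReyBellet2018
[assembly] NessUnique → OpenChainGreenKubo → GeneratorSiteEnergy → ParityStatics →
FeshbachIdentities → OrthogonalOhm → PositiveMemory → RobinCoercivity → NetworkReduction →
FouriersLaw (the sub-problem Statement decl `_root_.FouriersLaw`); proved by `closes`. -/
@[route_item "route-AtomisticToContinuum-HonestZwanzig"]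
def Assembly : Prop :=
  NessUnique → OpenChainGreenKubo → GeneratorSiteEnergy → ParityStatics → FeshbachIdentities → OrthogonalOhm → PositiveMemory → RobinCoercivity → NetworkReduction → _root_.FouriersLaw

-- `Assembly` holds: proved by `Summit.AtomisticToContinuum.FouriersLaw.Theorems.honestZwanzig_assembly_proof` @ f6d596a325fc (its module imports this route file, so no `_holds` link can be stated here).

/-! D-0027 §2.1 — DECIDING THEOREM (planner-authored via `route open/edit --closes-file`; by planner-plancard-AtomisticToContinuum-Fourier-cd83d032-g2-0 2026-08-15T18:56:09Z):
its hypotheses are this route's items and its conclusion the sub-problem Statement (glue_lint), and it elaborates with this file. -/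

/-- D-0027 §2.1 deciding theorem for route HonestZwanzig (conforming re-filing of FeshbachMemory): the route's
items imply the sub-problem Statement `FouriersLaw` (Summits/AtomisticToContinuum/FouriersLaw/Statement.lean).
NetworkReduction (support) turns GeneratorSiteEnergy + ParityStatics + FeshbachIdentities + the three cruxes
OrthogonalOhm, PositiveMemory, RobinCoercivity into MemoryConductivity (∫₀^∞corr(J,J)/(N−1) → k(T) > 0);
clause (i) from the PROVED `pinnedChain_exists_isSteadyState` + NessUnique; κ T := k(T)/T²; for a steady-state
family, D_N := (∫corr(J,J)/(N−1))/T² for N ≥ 2 (its δ-limit is OpenChainGreenKubo fed NessUnique) and D_N := 0 for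
N ≤ 1 (the chain has no bond: totalCurrent ≡ 0); D_N → κ T by MemoryConductivity / T². (planner; lean check rc 0,
axioms propext / Classical.choice / Quot.sound) -/
@[closes "route-AtomisticToContinuum-HonestZwanzig"] theorem closes (hNU : NessUnique) (hGK : OpenChainGreenKubo) (hGSE : GeneratorSiteEnergy)
    (hPS : ParityStatics) (hFI : FeshbachIdentities) (hOO : OrthogonalOhm) (hPM : PositiveMemory)
    (hRC : RobinCoercivity) (hNR : NetworkReduction) : _root_.FouriersLaw := by
  have hMC : MemoryConductivity := hNR hGSE hPS hFI hOO hPM hRC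
  intro ω₂ lam β γ hω hl hβ hγ
  have huniq := hNU ω₂ lam β γ hω hl hβ hγ
  refine ⟨?_, ?_⟩
  · -- clause (i): existence (landed theorem, all N) + uniqueness (item NessUnique)
    intro N T_L T_R hL hR
    obtain ⟨μ, hμ⟩ :=
      Literature.MathematicalPhysics.KineticTheory.HeatConduction.pinnedChain_exists_isSteadyState
        hω hl hβ hγ N hL hR
    exact ⟨μ, hμ, fun ν hν => huniq N T_L T_R hL hR ν μ hν hμ⟩
  · -- clause (ii)
    classical
    have hk : ∀ T : ℝ, 0 < T → ∃ k : ℝ, 0 < k ∧ Filter.Tendsto (fun N : ℕ =>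
        (let P := Literature.MathematicalPhysics.KineticTheory.HeatConduction.pinnedChain ω₂ lam β γ
         let X := Literature.MathematicalPhysics.KineticTheory.HeatConduction.PhaseSpace N
         let μ : MeasureTheory.Measure X := P.gibbsMeasure N T
         let J : X → ℝ := fun z => ∑ i : Fin N, P.bondCurrent N i z
         (∫ t in Set.Ioi (0 : ℝ), ((∫ z, J z * (∫ y, J y ∂(P.transitionKernel N T T t.toNNReal z)) ∂μ) -
            (∫ z, J z ∂μ) * (∫ z, J z ∂μ))) / ((N : ℝ) - 1))) Filter.atTop (nhds k) :=
      fun T hT => hMC ω₂ lam β γ hω hl hβ hγ T hT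
    refine ⟨fun T => if hT : 0 < T then Classical.choose (hk T hT) / T ^ 2 else 1, ?_, ?_⟩
    · intro T hT
      simp only [dif_pos hT]
      exact div_pos (Classical.choose_spec (hk T hT)).1 (pow_pos hT 2)
    · intro μf hμf T hT
      obtain ⟨-, hlim⟩ := Classical.choose_spec (hk T hT)
      -- no bond, no current: chains of length ≤ 1
      have htc0 : ∀ N : ℕ, N < 2 →
          ∀ ν : MeasureTheory.Measure (Literature.MathematicalPhysics.KineticTheory.HeatConduction.PhaseSpace N),
            (Literature.MathematicalPhysics.KineticTheory.HeatConduction.pinnedChain ω₂ lam β γ).totalCurrent ν = 0 := by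
        intro N hN ν
        unfold Literature.MathematicalPhysics.KineticTheory.HeatConduction.OscillatorChain.totalCurrent
        refine Finset.sum_eq_zero fun i _ => ?_
        have hz : (Literature.MathematicalPhysics.KineticTheory.HeatConduction.pinnedChain ω₂ lam β γ).bondCurrent N i =
            fun _ => 0 := by
          funext z
          unfold Literature.MathematicalPhysics.KineticTheory.HeatConduction.OscillatorChain.bondCurrent
          refine Finset.sum_eq_zero fun j _ => ?_
          have hj := j.isLt
          have hi := i.isLt
          rw [if_neg (by omega)]
        rw [hz, MeasureTheory.integral_zero]
      -- the response coefficients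
      let F : ℕ → ℝ := fun N =>
        (let P := Literature.MathematicalPhysics.KineticTheory.HeatConduction.pinnedChain ω₂ lam β γ
         let X := Literature.MathematicalPhysics.KineticTheory.HeatConduction.PhaseSpace N
         let μ : MeasureTheory.Measure X := P.gibbsMeasure N T
         let J : X → ℝ := fun z => ∑ i : Fin N, P.bondCurrent N i z
         (∫ t in Set.Ioi (0 : ℝ), ((∫ z, J z * (∫ y, J y ∂(P.transitionKernel N T T t.toNNReal z)) ∂μ) -
            (∫ z, J z ∂μ) * (∫ z, J z ∂μ))) / ((N : ℝ) - 1))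
      have hF : Filter.Tendsto F Filter.atTop (nhds (Classical.choose (hk T hT))) := hlim
      let D : ℕ → ℝ := fun N => if 2 ≤ N then F N / T ^ 2 else 0
      refine ⟨D, fun N => ?_, ?_⟩
      · by_cases hN : 2 ≤ N
        · -- N ≥ 2: the Kundu–Dhar–Narayan identity (item OpenChainGreenKubo, fed NessUnique)
          have h2 := (hGK ω₂ lam β γ hω hl hβ hγ huniq μf hμf T hT N hN).2
          have hDN : D N = F N / T ^ 2 := by simp only [D, if_pos hN]
          rw [hDN]
          convert h2 using 2
          simp only [F]
          rw [div_div]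
        · have hN' : N < 2 := Nat.lt_of_not_le hN
          have hDN : D N = 0 := by simp only [D, if_neg hN]
          rw [hDN]
          have hfun : (fun δ : ℝ =>
              (Literature.MathematicalPhysics.KineticTheory.HeatConduction.pinnedChain ω₂ lam β γ).totalCurrent
                (μf N (T + δ / 2) (T - δ / 2)) / δ) = fun _ => 0 := by
            funext δ
            rw [htc0 N hN', zero_div]
          rw [hfun]
          exact tendsto_const_nhds
      · simp only [dif_pos hT]
        have hev : (fun N => F N / T ^ 2) =ᶠ[Filter.atTop] D :=
          Filter.eventually_atTop.2 ⟨2, fun N hN => by simp only [D, if_pos hN]⟩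
        exact (hF.div_const (T ^ 2)).congr' hev

end Summit.AtomisticToContinuum.FouriersLaw.Theses.HonestZwanzig
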